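import Summits.QuantumFields.YangMills.Theorems.AlphaInputsT3ACv3LocalSmallBoxes
import HarnessLib

/-!
# `AlphaInputsT3ACv3LocalSmallHull` — STRATEGY B for 2′: THE GEOMETRY OF THE DEPENDENCY HULL — every bond of `LocalSmallLoop.hull R s` lies, at its own level, within
# `hullRad (i − s) = 2L·(L^{i−s} − 1)/(L − 1)` of the chain of block centres below SOME read bond `c₀ ∈ R i`, `i ≥ s` — lane `pub-balaban3d`, seat alpha-2 (g2)

WHAT.  The companion of `AlphaInputsT3ACv3LocalSmallBoxes` ((D6L) plumbing): there, membership in the localised class is reduced to fine-plaquette smallness on boxes around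
the chains below the CONE bonds; here the cone bonds are located relative to the READ bonds: ★ `near_read_of_mem_hull` — for `b ∈ hull R s` there are `i ≥ s`, a read bond
`c₀ ∈ R i` and the chain `xs` of block centres below `c₀.src` (`xs i = c₀.src`, `xs l = emb (xs (l+1))`) with `b.src` within `hullRad (i − s)` of `xs s` in every coordinate
(induction on the hull: a bond feeding `c` lies within `2L` of `emb c₋` — `exists_offset_of_blockOf_near` — and boxes descend along `emb` with radius `ρ ↦ L·ρ + 2L`,
`N21….mem_ball_emb_of_mem_ball`); `hullRad_le` (`hullRad n ≤ 3·L^n` for `L ≥ 3`).  So a profile's (D6L)-core obligation becomes: fine plaquettes small on boxes of radius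
`O(L^i)` (fine units `O(L^i·L^s… )`) around the chains below the READ bonds of `Λ_i(h)` — Ω-geometry only.
HONEST FRAMING.  Torus bookkeeping; no estimate; count-neutral helper toward R3 2′ (`stub_laneRecordsV3`, items 19935∕19936); nothing about d = 4, the continuum, or a mass gap.

References: T. Bałaban, Commun. Math. Phys. 109 (1987) 249–301 [Balaban1987RG1] ((0.1)–(0.3) pp.251–252); CMP 98 (1985) 17–51 [Balaban1985Averaging] ((15) p.19).
-/

set_option autoImplicit false

noncomputable section

namespace Summit.QuantumFields.YangMills.Theorems.LocalSmallLoop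

open Set
open Literature.MathematicalPhysics.QuantumFieldTheory.Balaban1983to89
open Summit.QuantumFields.YangMills.Theorems.N21LocalAveragedRegularity (exists_embChain mem_ball_emb_of_mem_ball)

variable {P : Params}

/-! ## §1 The hull radius -/

/-- **THE HULL RADIUS** after `n` descents: `hullRad 0 = 0`, `hullRad (n+1) = L·hullRad n + 2L` (`= 2L(L^n − 1)/(L − 1)`). [folklore] -/
def hullRad (P : Params) : ℕ → ℕ
  | 0 => 0
  | n + 1 => P.L * hullRad P n + 2 * P.L

/-- `hullRad` unfolds. [folklore] -/
@[simp] theorem hullRad_zero : hullRad P 0 = 0 := rfl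

/-- `hullRad` unfolds. [folklore] -/
theorem hullRad_succ (n : ℕ) : hullRad P (n + 1) = P.L * hullRad P n + 2 * P.L := rfl

/-- **`hullRad n ≤ 3·L^n`** for `L ≥ 3` (so the level-`s` cone of a level-`i` read bond has radius `≤ 3L^{i−s}` level-`s` units, `≤ 3L^i` fine units). [folklore] -/
theorem hullRad_le (hL : 3 ≤ P.L) : ∀ n : ℕ, hullRad P n + 3 ≤ 3 * P.L ^ n
  | 0 => by simp
  | n + 1 => by
    have ih := hullRad_le hL n
    rw [hullRad_succ, pow_succ]
    have h1 : P.L * (hullRad P n + 3) ≤ P.L * (3 * P.L ^ n) := Nat.mul_le_mul_left _ ih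
    nlinarith

/-! ## §2 A feeding bond lies within `2L` of the centre of the fed bond's source block -/

/-- A bond feeding `c` (`Feeds b c`: `b₋ ∈ B(c₋) ∪ B(c₊)`) has its source within `2L` of `emb c₋` in every coordinate. [cite: Balaban1985Averaging, (15) p.19] -/
theorem exists_offset_of_feeds {j : ℕ} (hj : j + 1 ≤ P.m + P.K) {b : PBond P j} {c : PBond P (j + 1)} (h : Feeds b c) (ν : Fin P.d) :
    ∃ e : ℤ, |e| ≤ ((2 * P.L : ℕ) : ℤ) ∧ b.src ν = (emb c.src) ν + (e : ZMod (P.sitesPerDir j)) :=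
  exists_offset_of_blockOf_near hj (Or.inr h) ν

/-! ## §3 Every hull bond is near the chain below some read bond -/

/-- **★ THE GEOMETRY OF THE DEPENDENCY HULL**: for `b ∈ hull R s` (all levels in the standing range `≤ m + K`) there are a level `i ≥ s`, a READ bond `c₀ ∈ R i` and the
chain of block centres `xs` below `c₀.src` (`xs i = c₀.src`, `xs l = emb (xs (l+1))` for `l < i`) such that `b.src` is within `hullRad (i − s)` of `xs s` in every
coordinate. [cite: Balaban1985Averaging, (15) p.19] -/
theorem near_read_of_mem_hull {R : (i : ℕ) → Set (PBond P i)} (hR : ∀ i, P.m + P.K < i → R i = ∅) {s : ℕ} {b : PBond P s} (hb : b ∈ hull R s) :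
    ∃ i, s ≤ i ∧ i ≤ P.m + P.K ∧ ∃ c₀ ∈ R i, ∃ xs : (l : ℕ) → Site P l, xs i = c₀.src ∧ (∀ l, l < i → xs l = emb (xs (l + 1))) ∧
      ∀ ν, ∃ e : ℤ, |e| ≤ (hullRad P (i - s) : ℤ) ∧ b.src ν = (xs s) ν + (e : ZMod (P.sitesPerDir s)) := by
  induction hb with
  | @base s b hb =>
    have hs : s ≤ P.m + P.K := by
      by_contra hlt
      rw [hR s (lt_of_not_ge hlt)] at hb
      exact hb
    obtain ⟨xs, hxs, hch⟩ := exists_embChain (P := P) s b.src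
    refine ⟨s, le_rfl, hs, b, hb, xs, hxs, hch, fun ν => ⟨0, by simp, ?_⟩⟩
    rw [hxs]; simp
  | @feeds s b c _ hbc ih =>
    obtain ⟨i, hsi, hi, c₀, hc₀, xs, hxi, hch, hnear⟩ := ih
    have hs1 : s + 1 ≤ P.m + P.K := hsi.trans hi
    have hxs : xs s = emb (xs (s + 1)) := hch s (Nat.lt_of_succ_le hsi)
    have hw : ∀ ν, ∃ e : ℤ, |e| ≤ ((2 * P.L : ℕ) : ℤ) ∧ b.src ν = (emb c.src) ν + (e : ZMod (P.sitesPerDir s)) :=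
      fun ν => exists_offset_of_feeds hs1 hbc ν
    have hz : ∀ ν, ∃ e : ℤ, |e| ≤ ((hullRad P (i - (s + 1)) : ℕ) : ℤ) ∧ c.src ν = (xs (s + 1)) ν + (e : ZMod (P.sitesPerDir (s + 1))) := hnear
    have hcomb := mem_ball_emb_of_mem_ball (P := P) hz hw
    refine ⟨i, Nat.le_of_succ_le hsi, hi, c₀, hc₀, xs, hxi, hch, fun ν => ?_⟩
    obtain ⟨e, he, hbe⟩ := hcomb ν
    refine ⟨e, he.trans ?_, by rw [hxs]; exact hbe⟩
    have hn : i - s = (i - (s + 1)) + 1 := by omega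
    rw [hn, hullRad_succ]

end Summit.QuantumFields.YangMills.Theorems.LocalSmallLoop

end
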